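import Summits.QuantumFields.BalabanUV.Beta.GAN24.CouplingWordsAtCouplingVolumeLimit
import Summits.QuantumFields.BalabanUV.Beta.GAN24.CouplingEffectiveFormVolumeLimit
import Summits.QuantumFields.BalabanUV.Beta.GAN24.BackgroundExpansionAllOrders

/-!
# `BalabanUV.Beta.GAN24.CouplingDiagramsAtCoupling` — binder row G-an2-4 ∕ (CONV-C), route R7 «TWO CURRENCIES», PART 264: EVERY DIAGRAM IN COUPLING LETTERS AT A BASE POINT HAS
# THE β-CELL's WHOLE `LimitRate` END ON `ℤ^d`, MODULO ONLY EL₁ OF THE BACKGROUNDS.  Letters at the base point `u·A₀` (`A₀ = P(U₁) + P(U₂)ᴴ + diag Z` a SMALL coupling letter on its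
# disc `Tκ₀ ≤ 1∕2`, `Tκ_c ≤ 1∕2`, `4Tκ₀Cst ≤ γ_B`; `‖u‖ ≤ T`): `none ↦ c_k(u)⁻¹ = (L^{dk}Q_k(Δ_a^{(k)} + uA₀^{(k)})⁻¹Q_kᴴ)⁻¹` (the VALUE sector, PARTs 248–250) and `some w ↦ X_{w,k}(u) =
# L^{dk}Q_k(𝒢_k(u)A_{i₁}𝒢_k(u)⋯𝒢_k(u))Q_kᴴ` (PARTs 261–263) for an arbitrary family of coupling letters `A_i = P(V₁ᵢ) + P(V₂ᵢ)ᴴ + diag Wᵢ`; every DIAGRAM (finite product of letters)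
# and every finite `ℂ`-combination of diagrams has the INPUT triple along the even cubic volumes (PART 160 §1's closure, GENERIC) and hence the END (PART 140).  Since every mixed
# derivative `∂_{s_{i₁}}⋯∂_{s_{i_n}}` of `s ↦ c_k(uA₀ + Σ_i s_iA_i)⁻¹` at `s = 0` is a signed sum of such diagrams (Faà di Bruno for the inverse; PART 251 is the mixed second partial from
# separate jets), this is the background expansion of the effective form to all orders AROUND A NONZERO SMALL BACKGROUND — e.g. the one-loop Hessian at `U₀ = e^{iηA₀} ≠ 1`, base
# letter `Δ^{U₀} − Δ^1` (NE2's `covPert_eq`) at `u = 1` when admissible (PART 238 is the base point `0`) (unit b2b-balaban-gan24-p3, gen 67; v1; generator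
# `HOME/b2b-balaban-gan24-p3/gen67/records/gen/gen264.py`)

NOT IN PRINT; OUR PROOF ([folklore] bookkeeping BY NAME over PART 263 (`couplingWordAt_inputs`), PART 248 (`exists_decay_inv_pertCov_QB_coupling`,
`twoLevelDecayRate_effForm_perturbed_coupling`), PART 250 (`tendsto_inv_pertCov_pair_coupling`), PART 160 §1 (`list_prod_inputs`, `sum_inputs`), PART 140 (`conv_of_decay_of_tendsto`),
`entryDecay_of_le_rate`, `twoLevelDecayRate_of_le_rate`, `distK_self ∕ distK_nonneg`; [Balaban1987RG1] (1.21)–(1.22) p. 264 LOCATE the shapes; nothing printed is a hypothesis).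
HONEST FRAMING (cell contract, verbatim): «discharging `BetaPertH` makes Bałaban's UV stability UNCONDITIONAL — a real constructive-QFT result; it is NOT the
continuum limit and NOT the Clay problem.»  HONEST DEPENDENCY (verbatim): «continuum YM on T⁴ ⇐ BetaPertH ∧ nine spine estimates (0/9 proved); BetaPertH ⇐
(D1) ∧ (D4) ∧ CAP+tail; G-an2-4 gates asym, D1 and NE2/3/4.»

WHAT THIS FILE PROVES (0 sorry, 0 `def`; `d ≥ 3`, `L ≥ 2`, `a > 0`, even cubic volumes `2(t+1)`; admissible `(a′, κ)`; base constants `(α₀, β₀, α₀′, β₀′)` on the three-condition disc,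
`‖u‖ ≤ T`; family constants `(α, β, α′, β′)`; EL₁ of `U₁, U₂, Z, V₁ᵢ, V₂ᵢ, Wᵢ` DISPLAYED):
* **`invPertCov_inputs_coupling`** (the letter `c_k(u)⁻¹`), **`couplingLetterAt_inputs`**, **`couplingDiagramAt_inputs`** (every `ℓ : List (Option (List σ))`),
  **`couplingDiagramSumAt_inputs`** — the INPUT triple ((UD), (SR), EL₂).
* **`conv_couplingDiagramSumAt_of_tendsto_background`** (`μ ≠ ν`): `∃ κ > 0, B, B′ ≥ 0, Π` with `IsInfiniteVolumeLimit`, `UniformDecay Π μ ν B (κ∕d)`, `StepRate Π μ ν B′ (κ∕d) (√(L⁻¹))`,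
  `KernelInputs d Π`, `∀ k, |secondMoment (Π k) μ ν − secondMoment (limKernelOf Π) μ ν| ≤ β′_d(B′∕(1−√(L⁻¹)), κ∕d)·(√(L⁻¹))^k` — for EVERY finite combination of diagrams at the base point.
WHAT IT DOES NOT DO: the identification of the Hessian at `U₀` with a five-diagram combination at the base letter `Δ^{U₀} − Δ^1` (PART 251's generic mixed partial at the base `D =
Δ_a + covPert U₀`; successor); couplings outside the disc; colour; Bałaban's `−∂P∂*` ∕ `aQ(U)*Q(U)` parts.  SUPPLIER work; NEVER «G-an2-4 closed»; NOT (CONV-C), NOT D1, NOT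
`BetaPertH`, NOT continuum, NOT Clay.  Records: `HOME/b2b-balaban-gan24-p3/gen67/README.md`.
-/

noncomputable section

open scoped BigOperators ComplexConjugate Matrix Matrix.Norms.L2Operator
open Filter Topology

namespace Summit.QuantumFields.BalabanUV.Beta.GAN24.CouplingDiagramsAtCoupling

open Literature.MathematicalPhysics.QuantumFieldTheory.Balaban1983to89
open Literature.MathematicalPhysics.QuantumFieldTheory.Balaban1983to89.B5Prop11Plancherel (Tor fine Cst Cst_nonneg)
open Literature.MathematicalPhysics.QuantumFieldTheory.Balaban1983to89.B5G183RateUnitTower (lev)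
open Literature.MathematicalPhysics.QuantumFieldTheory.Balaban1983to89.B12Sec2to5 (l1 betaPrime510)
open Literature.MathematicalPhysics.QuantumFieldTheory.Balaban1983to89.Beta (Site IsInfiniteVolumeLimit)
open Literature.MathematicalPhysics.QuantumFieldTheory.Balaban1983to89.Beta.FreeLegDictionary (cubic)
open Literature.MathematicalPhysics.QuantumFieldTheory.Balaban1983to89.Beta.BlockKernelVolumeSockets (evenPeriod tendsto_evenPeriod)
open Literature.MathematicalPhysics.QuantumFieldTheory.Balaban1983to89.Beta.VectorTails (castT)
open Literature.MathematicalPhysics.QuantumFieldTheory.Balaban1983to89.Beta.LimitRate (StepRate limKernelOf KernelInputs)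
open Summit.QuantumFields.BalabanUV.T4Continuum
open Summit.QuantumFields.BalabanUV.T4Continuum.CovariantAveragingTower (avgTow)
open Summit.QuantumFields.BalabanUV.T4Continuum.BalabanAveragedTowerUnit (idx QBlev)
open Summit.QuantumFields.BalabanUV.T4Continuum.BalabanAveragedCoerciveTower (unitIdx)
open Summit.QuantumFields.BalabanUV.T4Continuum.BalabanAveragedCoercive (gammaB)
open Summit.QuantumFields.BalabanUV.T4Continuum.KingPairingPlantedLaw (calDalev)
open Summit.QuantumFields.BalabanUV.T4Continuum.FirstOrderBackgroundModel (LipschitzBackground Pmodel)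
open Summit.QuantumFields.BalabanUV.T4Continuum.PerturbationAlgebra (BoundedBackground)
open Summit.QuantumFields.BalabanUV.T4Continuum.CTKingTowerWeights (distK)
open Summit.QuantumFields.BalabanUV.T4Continuum.CTConjugatedHbd (G2)
open Summit.QuantumFields.BalabanUV.T4Continuum.DirichletRegionTower (gamD)
open Summit.QuantumFields.BalabanUV.T4Continuum.ScalarAveragedPropagator (gammaPs)
open Summit.QuantumFields.BalabanUV.T4Continuum.ScalarAveragedCompression (sigma0)
open Summit.QuantumFields.BalabanUV.T4Continuum.CTScalarGreen (Jfree)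
open Summit.QuantumFields.BalabanUV.T4Continuum.CTGaugeTerm (deltaK)
open Summit.QuantumFields.BalabanUV.T4Continuum.CTVectorPropagator (JA)
open Summit.QuantumFields.BalabanUV.T4Continuum.DecayRateInterpolation (EntryDecay TwoLevelDecayRate)
open Summit.QuantumFields.BalabanUV.Beta.GAN24.UnitLatticeDecayAlgebra (distK_nonneg distK_self)
open Summit.QuantumFields.BalabanUV.Beta.GAN24.EffectiveFormDecay (entryDecay_of_le_rate)
open Summit.QuantumFields.BalabanUV.Beta.GAN24.DiagramDecayAlgebra (twoLevelDecayRate_of_le_rate)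
open Summit.QuantumFields.BalabanUV.Beta.GAN24.DiagramVolumeLimit (conv_of_decay_of_tendsto)
open Summit.QuantumFields.BalabanUV.Beta.GAN24.BackgroundExpansionAllOrders (list_prod_inputs sum_inputs)
open Summit.QuantumFields.BalabanUV.Beta.GAN24.CouplingEffectiveFormDecay (exists_decay_inv_pertCov_QB_coupling twoLevelDecayRate_effForm_perturbed_coupling)
open Summit.QuantumFields.BalabanUV.Beta.GAN24.CouplingEffectiveFormVolumeLimit (tendsto_inv_pertCov_pair_coupling)
open Summit.QuantumFields.BalabanUV.Beta.GAN24.CouplingWordsAtCouplingVolumeLimit (couplingWordAt_inputs)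

variable {d : ℕ} (L : ℕ) [NeZero L] (a : ℝ) (ha : 0 < a)

/-! ## §1 The letter `c_k(u)⁻¹` (the VALUE sector's INPUT triple on the disc) -/

/-- **`invPertCov_inputs_coupling` — THE INPUT TRIPLE OF THE LETTER `c_k(u)⁻¹ = (L^{dk}Q_k(Δ_a^{(k)} + uA₀^{(k)})⁻¹Q_kᴴ)⁻¹` ALONG THE EVEN CUBIC VOLUMES** [our proof] (`d ≥ 3`,
`L ≥ 2`; base coupling letter `A₀ = P(U₁) + P(U₂)ᴴ + diag Z` with constants `(α₀, β₀, α₀′, β₀′)` on the three-condition disc; `‖u‖ ≤ T`; EL₁ of `U₁, U₂, Z` DISPLAYED): (UD) from PART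
248's `exists_decay_inv_pertCov_QB_coupling`, (SR) from PART 248's `twoLevelDecayRate_effForm_perturbed_coupling` at regulator `0`, EL₂ from PART 250's `tendsto_inv_pertCov_pair_coupling`;
rates matched by monotonicity (PART 250's END carries the same triple inside its proof; here it is exposed as a LETTER for PART 160's closure).
[cite: Balaban1987RG1, (1.21)–(1.22) p.264 (shapes)] -/
theorem invPertCov_inputs_coupling (hL : 2 ≤ L) (hd : 3 ≤ d) {α₀ β₀ α₀' β₀' a' κ T : ℝ} (hα₀ : 0 ≤ α₀) (hβ₀ : 0 ≤ β₀) (hα₀' : 0 ≤ α₀') (hβ₀' : 0 ≤ β₀')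
    (ha' : 0 < a') (hκ0 : 0 < κ)
    (hγ' : Jfree d a' κ 1 < gammaPs d a') (hδ' : deltaK d a' κ 1 < sigma0 d a' ^ 2) (hJA : JA d a a' κ 1 < gamD d a) (hT0 : 0 ≤ T)
    (hT₁ : T * (2 * (d * (α₀ + β₀) * Cst d a) + α₀' * Cst d a) ≤ 1 / 2)
    (hT₂ : T * (d * (α₀ * G2 d a (max (JA d a a' κ 1) 0) (gamD d a - max (JA d a a' κ 1) 0) κ)
      + d * (Real.exp |κ| * (α₀ * G2 d a (max (JA d a a' κ 1) 0) (gamD d a - max (JA d a a' κ 1) 0) κ + β₀ * (gamD d a - max (JA d a a' κ 1) 0)⁻¹))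
      + α₀' * (gamD d a - max (JA d a a' κ 1) 0)⁻¹) ≤ 1 / 2)
    (hT₃ : 4 * T * (2 * (d * (α₀ + β₀) * Cst d a) + α₀' * Cst d a) * Cst d a ≤ gammaB d a)
    {U₁ U₂ : (t : ℕ) → (k : ℕ) → Fin d → (idx L (cubic d (evenPeriod t)) k → ℂ)} {Z : (t : ℕ) → (k : ℕ) → (idx L (cubic d (evenPeriod t)) k → ℂ)}
    (hU₁ : ∀ t, LipschitzBackground L (cubic d (evenPeriod t)) (U₁ t) α₀ β₀) (hU₂ : ∀ t, LipschitzBackground L (cubic d (evenPeriod t)) (U₂ t) α₀ β₀)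
    (hZ : ∀ t, BoundedBackground L (cubic d (evenPeriod t)) (Z t) α₀' β₀')
    (hU₁1 : ∀ k (μ f : Fin d) (z : Fin d → ℤ), ∃ s : ℂ, Tendsto (fun t => U₁ t k μ (castT (cubic d (lev L k * evenPeriod t)) z, f)) atTop (𝓝 s))
    (hU₂1 : ∀ k (μ f : Fin d) (z : Fin d → ℤ), ∃ s : ℂ, Tendsto (fun t => U₂ t k μ (castT (cubic d (lev L k * evenPeriod t)) z, f)) atTop (𝓝 s))
    (hZ1 : ∀ k (f : Fin d) (z : Fin d → ℤ), ∃ s : ℂ, Tendsto (fun t => Z t k (castT (cubic d (lev L k * evenPeriod t)) z, f)) atTop (𝓝 s))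
    {u : ℂ} (hu : ‖u‖ ≤ T) :
    ∃ κ₁ B B' : ℝ, 0 < κ₁ ∧ 0 ≤ B ∧ 0 ≤ B' ∧
      (∀ t k, EntryDecay (distK L (cubic d (evenPeriod t)))
        ((fun t k => (avgTow (QBlev L (cubic d (evenPeriod t))) ((L : ℝ) ^ d)
            (fun k' => (calDalev L (cubic d (evenPeriod t)) a ha k' + u • (Pmodel L (cubic d (evenPeriod t)) (U₁ t) k' + (Pmodel L (cubic d (evenPeriod t)) (U₂ t) k')ᴴ + Matrix.diagonal (Z t k')))⁻¹) k)⁻¹) t k) B κ₁) ∧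
      (∀ t, TwoLevelDecayRate (distK L (cubic d (evenPeriod t)))
        ((fun t k => (avgTow (QBlev L (cubic d (evenPeriod t))) ((L : ℝ) ^ d)
            (fun k' => (calDalev L (cubic d (evenPeriod t)) a ha k' + u • (Pmodel L (cubic d (evenPeriod t)) (U₁ t) k' + (Pmodel L (cubic d (evenPeriod t)) (U₂ t) k')ᴴ + Matrix.diagonal (Z t k')))⁻¹) k)⁻¹) t) B' κ₁ (Real.sqrt ((L : ℝ)⁻¹))) ∧
      (∀ k μ ν (z z' : Fin d → ℤ), ∃ s' : ℂ, Tendsto (fun t =>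
        (fun t k => (avgTow (QBlev L (cubic d (evenPeriod t))) ((L : ℝ) ^ d)
            (fun k' => (calDalev L (cubic d (evenPeriod t)) a ha k' + u • (Pmodel L (cubic d (evenPeriod t)) (U₁ t) k' + (Pmodel L (cubic d (evenPeriod t)) (U₂ t) k')ᴴ + Matrix.diagonal (Z t k')))⁻¹) k)⁻¹) t k
        ((unitIdx L (cubic d (evenPeriod t))).symm (castT (cubic d (evenPeriod t)) z, μ)) ((unitIdx L (cubic d (evenPeriod t))).symm (castT (cubic d (evenPeriod t)) z', ν)))
        atTop (𝓝 s')) := by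
  have hd1 : 1 ≤ d := le_trans (by norm_num) hd
  have hd2 : 2 ≤ d := le_trans (by norm_num) hd
  have hθ0 : 0 ≤ Real.sqrt ((L : ℝ)⁻¹) := Real.sqrt_nonneg _
  obtain ⟨κ₁, B₁, hκ₁, hB₁, hud⟩ := exists_decay_inv_pertCov_QB_coupling L a ha hd2 ⟨hα₀, hβ₀⟩ ⟨hα₀', hβ₀'⟩ ha' hκ0 hγ' hδ' hJA hT0 hT₁ hT₂ hT₃
  obtain ⟨κ₂, B₂, hκ₂, hsr⟩ := twoLevelDecayRate_effForm_perturbed_coupling L a ha hL hd2 ⟨hα₀, hβ₀⟩ ⟨hα₀', hβ₀'⟩ ha' hκ0 hγ' hδ' hJA hT0 hT₁ hT₂ hT₃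
  -- `B₂ ≥ 0`, read off one diagonal entry
  have hB₂ : 0 ≤ B₂ := by
    have x : idx L (cubic d (evenPeriod 0)) 0 := ((fun _ => 0), ⟨0, hd1⟩)
    have h := hsr (cubic d (evenPeriod 0)) (U₁ 0) (U₂ 0) (Z 0) (hU₁ 0) (hU₂ 0) (hZ 0) u hu 0 0 x x
    rw [pow_zero, mul_one, distK_self, mul_zero, neg_zero, Real.exp_zero, mul_one] at h
    exact (norm_nonneg _).trans h
  set δ₀ : ℝ := min κ₁ (κ₂ / 2) with hδ₀
  have hδ₀0 : 0 < δ₀ := lt_min hκ₁ (half_pos hκ₂)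
  refine ⟨δ₀, B₁, B₂, hδ₀0, hB₁.le, hB₂, fun t k => ?_, fun t => ?_, fun k μ ν z z' => ?_⟩
  · exact entryDecay_of_le_rate (distK_nonneg L (cubic d (evenPeriod t))) (hud (cubic d (evenPeriod t)) (U₁ t) (U₂ t) (Z t) (hU₁ t) (hU₂ t) (hZ t) u hu k) hB₁.le
      (min_le_left _ _)
  · have h := hsr (cubic d (evenPeriod t)) (U₁ t) (U₂ t) (Z t) (hU₁ t) (hU₂ t) (hZ t) u hu 0
    simp only [zero_smul, sub_zero] at h
    exact twoLevelDecayRate_of_le_rate (distK_nonneg L (cubic d (evenPeriod t))) h hB₂ hθ0 ((min_le_right _ _).trans (le_of_eq rfl))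
  · exact tendsto_inv_pertCov_pair_coupling L a ha hd ha' hκ0 hγ' hδ' hJA hT₁ hT₂ hT₃ k hU₁ hU₂ hZ (hU₁1 k) (hU₂1 k) (hZ1 k) hu μ ν z z'

/-! ## §2 The letters, every diagram, every finite linear combination of diagrams, the END — at the base point -/

/-- INPUTS of a LETTER at the base point: `c_k(u)⁻¹` (§1) or `X_{w,k}(u)` (PART 263's `couplingWordAt_inputs`). [our proof] -/
theorem couplingLetterAt_inputs (hL : 2 ≤ L) (hd : 3 ≤ d) {σ : Type*} {α₀ β₀ α₀' β₀' α β α' β' a' κ T : ℝ} (hα₀ : 0 ≤ α₀) (hβ₀ : 0 ≤ β₀) (hα₀' : 0 ≤ α₀') (hβ₀' : 0 ≤ β₀')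
    (hα : 0 ≤ α) (hβ : 0 ≤ β) (hα' : 0 ≤ α') (hβ' : 0 ≤ β')
    (ha' : 0 < a') (hκ0 : 0 < κ)
    (hγ' : Jfree d a' κ 1 < gammaPs d a') (hδ' : deltaK d a' κ 1 < sigma0 d a' ^ 2) (hJA : JA d a a' κ 1 < gamD d a) (hT0 : 0 ≤ T)
    (hT₁ : T * (2 * (d * (α₀ + β₀) * Cst d a) + α₀' * Cst d a) ≤ 1 / 2)
    (hT₂ : T * (d * (α₀ * G2 d a (max (JA d a a' κ 1) 0) (gamD d a - max (JA d a a' κ 1) 0) κ)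
      + d * (Real.exp |κ| * (α₀ * G2 d a (max (JA d a a' κ 1) 0) (gamD d a - max (JA d a a' κ 1) 0) κ + β₀ * (gamD d a - max (JA d a a' κ 1) 0)⁻¹))
      + α₀' * (gamD d a - max (JA d a a' κ 1) 0)⁻¹) ≤ 1 / 2)
    (hT₃ : 4 * T * (2 * (d * (α₀ + β₀) * Cst d a) + α₀' * Cst d a) * Cst d a ≤ gammaB d a)
    {U₁ U₂ : (t : ℕ) → (k : ℕ) → Fin d → (idx L (cubic d (evenPeriod t)) k → ℂ)} {Z : (t : ℕ) → (k : ℕ) → (idx L (cubic d (evenPeriod t)) k → ℂ)}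
    (hU₁ : ∀ t, LipschitzBackground L (cubic d (evenPeriod t)) (U₁ t) α₀ β₀) (hU₂ : ∀ t, LipschitzBackground L (cubic d (evenPeriod t)) (U₂ t) α₀ β₀)
    (hZ : ∀ t, BoundedBackground L (cubic d (evenPeriod t)) (Z t) α₀' β₀')
    (hU₁1 : ∀ k (μ f : Fin d) (z : Fin d → ℤ), ∃ s : ℂ, Tendsto (fun t => U₁ t k μ (castT (cubic d (lev L k * evenPeriod t)) z, f)) atTop (𝓝 s))
    (hU₂1 : ∀ k (μ f : Fin d) (z : Fin d → ℤ), ∃ s : ℂ, Tendsto (fun t => U₂ t k μ (castT (cubic d (lev L k * evenPeriod t)) z, f)) atTop (𝓝 s))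
    (hZ1 : ∀ k (f : Fin d) (z : Fin d → ℤ), ∃ s : ℂ, Tendsto (fun t => Z t k (castT (cubic d (lev L k * evenPeriod t)) z, f)) atTop (𝓝 s))
    {V₁ V₂ : σ → (t : ℕ) → (k : ℕ) → Fin d → (idx L (cubic d (evenPeriod t)) k → ℂ)} {W : σ → (t : ℕ) → (k : ℕ) → (idx L (cubic d (evenPeriod t)) k → ℂ)}
    (hV₁ : ∀ i t, LipschitzBackground L (cubic d (evenPeriod t)) (V₁ i t) α β) (hV₂ : ∀ i t, LipschitzBackground L (cubic d (evenPeriod t)) (V₂ i t) α β)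
    (hW : ∀ i t, BoundedBackground L (cubic d (evenPeriod t)) (W i t) α' β')
    (hV₁1 : ∀ i k (μ f : Fin d) (z : Fin d → ℤ), ∃ s : ℂ, Tendsto (fun t => V₁ i t k μ (castT (cubic d (lev L k * evenPeriod t)) z, f)) atTop (𝓝 s))
    (hV₂1 : ∀ i k (μ f : Fin d) (z : Fin d → ℤ), ∃ s : ℂ, Tendsto (fun t => V₂ i t k μ (castT (cubic d (lev L k * evenPeriod t)) z, f)) atTop (𝓝 s))
    (hW1 : ∀ i k (f : Fin d) (z : Fin d → ℤ), ∃ s : ℂ, Tendsto (fun t => W i t k (castT (cubic d (lev L k * evenPeriod t)) z, f)) atTop (𝓝 s))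
    {u : ℂ} (hu : ‖u‖ ≤ T) (o : Option (List σ)) :
    ∃ κ₁ B B' : ℝ, 0 < κ₁ ∧ 0 ≤ B ∧ 0 ≤ B' ∧
      (∀ t k, EntryDecay (distK L (cubic d (evenPeriod t)))
        (o.elim (fun t k => (avgTow (QBlev L (cubic d (evenPeriod t))) ((L : ℝ) ^ d)
            (fun k' => (calDalev L (cubic d (evenPeriod t)) a ha k' + u • (Pmodel L (cubic d (evenPeriod t)) (U₁ t) k' + (Pmodel L (cubic d (evenPeriod t)) (U₂ t) k')ᴴ + Matrix.diagonal (Z t k')))⁻¹) k)⁻¹)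
          (fun w t k => avgTow (QBlev L (cubic d (evenPeriod t))) ((L : ℝ) ^ d)
            (fun k' => List.foldr (fun i N =>
                (calDalev L (cubic d (evenPeriod t)) a ha k' + u • (Pmodel L (cubic d (evenPeriod t)) (U₁ t) k' + (Pmodel L (cubic d (evenPeriod t)) (U₂ t) k')ᴴ + Matrix.diagonal (Z t k')))⁻¹
                * (Pmodel L (cubic d (evenPeriod t)) (V₁ i t) k' + (Pmodel L (cubic d (evenPeriod t)) (V₂ i t) k')ᴴ + Matrix.diagonal (W i t k')) * N)
              (calDalev L (cubic d (evenPeriod t)) a ha k' + u • (Pmodel L (cubic d (evenPeriod t)) (U₁ t) k' + (Pmodel L (cubic d (evenPeriod t)) (U₂ t) k')ᴴ + Matrix.diagonal (Z t k')))⁻¹ w) k) t k) B κ₁) ∧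
      (∀ t, TwoLevelDecayRate (distK L (cubic d (evenPeriod t)))
        (o.elim (fun t k => (avgTow (QBlev L (cubic d (evenPeriod t))) ((L : ℝ) ^ d)
            (fun k' => (calDalev L (cubic d (evenPeriod t)) a ha k' + u • (Pmodel L (cubic d (evenPeriod t)) (U₁ t) k' + (Pmodel L (cubic d (evenPeriod t)) (U₂ t) k')ᴴ + Matrix.diagonal (Z t k')))⁻¹) k)⁻¹)
          (fun w t k => avgTow (QBlev L (cubic d (evenPeriod t))) ((L : ℝ) ^ d)
            (fun k' => List.foldr (fun i N =>
                (calDalev L (cubic d (evenPeriod t)) a ha k' + u • (Pmodel L (cubic d (evenPeriod t)) (U₁ t) k' + (Pmodel L (cubic d (evenPeriod t)) (U₂ t) k')ᴴ + Matrix.diagonal (Z t k')))⁻¹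
                * (Pmodel L (cubic d (evenPeriod t)) (V₁ i t) k' + (Pmodel L (cubic d (evenPeriod t)) (V₂ i t) k')ᴴ + Matrix.diagonal (W i t k')) * N)
              (calDalev L (cubic d (evenPeriod t)) a ha k' + u • (Pmodel L (cubic d (evenPeriod t)) (U₁ t) k' + (Pmodel L (cubic d (evenPeriod t)) (U₂ t) k')ᴴ + Matrix.diagonal (Z t k')))⁻¹ w) k) t) B' κ₁ (Real.sqrt ((L : ℝ)⁻¹))) ∧
      (∀ k μ ν (z z' : Fin d → ℤ), ∃ s' : ℂ, Tendsto (fun t =>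
        o.elim (fun t k => (avgTow (QBlev L (cubic d (evenPeriod t))) ((L : ℝ) ^ d)
            (fun k' => (calDalev L (cubic d (evenPeriod t)) a ha k' + u • (Pmodel L (cubic d (evenPeriod t)) (U₁ t) k' + (Pmodel L (cubic d (evenPeriod t)) (U₂ t) k')ᴴ + Matrix.diagonal (Z t k')))⁻¹) k)⁻¹)
          (fun w t k => avgTow (QBlev L (cubic d (evenPeriod t))) ((L : ℝ) ^ d)
            (fun k' => List.foldr (fun i N =>
                (calDalev L (cubic d (evenPeriod t)) a ha k' + u • (Pmodel L (cubic d (evenPeriod t)) (U₁ t) k' + (Pmodel L (cubic d (evenPeriod t)) (U₂ t) k')ᴴ + Matrix.diagonal (Z t k')))⁻¹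
                * (Pmodel L (cubic d (evenPeriod t)) (V₁ i t) k' + (Pmodel L (cubic d (evenPeriod t)) (V₂ i t) k')ᴴ + Matrix.diagonal (W i t k')) * N)
              (calDalev L (cubic d (evenPeriod t)) a ha k' + u • (Pmodel L (cubic d (evenPeriod t)) (U₁ t) k' + (Pmodel L (cubic d (evenPeriod t)) (U₂ t) k')ᴴ + Matrix.diagonal (Z t k')))⁻¹ w) k) t k
        ((unitIdx L (cubic d (evenPeriod t))).symm (castT (cubic d (evenPeriod t)) z, μ)) ((unitIdx L (cubic d (evenPeriod t))).symm (castT (cubic d (evenPeriod t)) z', ν)))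
        atTop (𝓝 s')) := by
  cases o with
  | none =>
    obtain ⟨κ₁, B, B', hκ₁, hB, hB', hud, hsr, hel⟩ := invPertCov_inputs_coupling L a ha hL hd hα₀ hβ₀ hα₀' hβ₀' ha' hκ0 hγ' hδ' hJA hT0 hT₁ hT₂ hT₃ hU₁ hU₂ hZ hU₁1 hU₂1
      hZ1 hu
    exact ⟨κ₁, B, B', hκ₁, hB, hB', hud, hsr, hel⟩
  | some w =>
    obtain ⟨κ₁, B, B', hκ₁, hB, hB', hud, hsr, hel⟩ := couplingWordAt_inputs L a ha hL hd hα₀ hβ₀ hα₀' hβ₀' hα hβ hα' hβ' ha' hκ0 hγ' hδ' hJA hT0 hT₁ hT₂ hU₁ hU₂ hZ hU₁1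
      hU₂1 hZ1 hV₁ hV₂ hW hV₁1 hV₂1 hW1 hu w
    exact ⟨κ₁, B, B', hκ₁, hB, hB', hud, hsr, hel⟩

/-- **`couplingDiagramAt_inputs` — EVERY DIAGRAM AT THE BASE POINT HAS THE INPUT TRIPLE** [our proof]: for every `ℓ : List (Option (List σ))` the pointwise product of its letters
(`none ↦ c_k(u)⁻¹`, `some w ↦ X_{w,k}(u)`) has INPUTS — PART 160's `list_prod_inputs` on `couplingLetterAt_inputs`. -/
theorem couplingDiagramAt_inputs (hL : 2 ≤ L) (hd : 3 ≤ d) {σ : Type*} {α₀ β₀ α₀' β₀' α β α' β' a' κ T : ℝ} (hα₀ : 0 ≤ α₀) (hβ₀ : 0 ≤ β₀) (hα₀' : 0 ≤ α₀') (hβ₀' : 0 ≤ β₀')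
    (hα : 0 ≤ α) (hβ : 0 ≤ β) (hα' : 0 ≤ α') (hβ' : 0 ≤ β')
    (ha' : 0 < a') (hκ0 : 0 < κ)
    (hγ' : Jfree d a' κ 1 < gammaPs d a') (hδ' : deltaK d a' κ 1 < sigma0 d a' ^ 2) (hJA : JA d a a' κ 1 < gamD d a) (hT0 : 0 ≤ T)
    (hT₁ : T * (2 * (d * (α₀ + β₀) * Cst d a) + α₀' * Cst d a) ≤ 1 / 2)
    (hT₂ : T * (d * (α₀ * G2 d a (max (JA d a a' κ 1) 0) (gamD d a - max (JA d a a' κ 1) 0) κ)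
      + d * (Real.exp |κ| * (α₀ * G2 d a (max (JA d a a' κ 1) 0) (gamD d a - max (JA d a a' κ 1) 0) κ + β₀ * (gamD d a - max (JA d a a' κ 1) 0)⁻¹))
      + α₀' * (gamD d a - max (JA d a a' κ 1) 0)⁻¹) ≤ 1 / 2)
    (hT₃ : 4 * T * (2 * (d * (α₀ + β₀) * Cst d a) + α₀' * Cst d a) * Cst d a ≤ gammaB d a)
    {U₁ U₂ : (t : ℕ) → (k : ℕ) → Fin d → (idx L (cubic d (evenPeriod t)) k → ℂ)} {Z : (t : ℕ) → (k : ℕ) → (idx L (cubic d (evenPeriod t)) k → ℂ)}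
    (hU₁ : ∀ t, LipschitzBackground L (cubic d (evenPeriod t)) (U₁ t) α₀ β₀) (hU₂ : ∀ t, LipschitzBackground L (cubic d (evenPeriod t)) (U₂ t) α₀ β₀)
    (hZ : ∀ t, BoundedBackground L (cubic d (evenPeriod t)) (Z t) α₀' β₀')
    (hU₁1 : ∀ k (μ f : Fin d) (z : Fin d → ℤ), ∃ s : ℂ, Tendsto (fun t => U₁ t k μ (castT (cubic d (lev L k * evenPeriod t)) z, f)) atTop (𝓝 s))
    (hU₂1 : ∀ k (μ f : Fin d) (z : Fin d → ℤ), ∃ s : ℂ, Tendsto (fun t => U₂ t k μ (castT (cubic d (lev L k * evenPeriod t)) z, f)) atTop (𝓝 s))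
    (hZ1 : ∀ k (f : Fin d) (z : Fin d → ℤ), ∃ s : ℂ, Tendsto (fun t => Z t k (castT (cubic d (lev L k * evenPeriod t)) z, f)) atTop (𝓝 s))
    {V₁ V₂ : σ → (t : ℕ) → (k : ℕ) → Fin d → (idx L (cubic d (evenPeriod t)) k → ℂ)} {W : σ → (t : ℕ) → (k : ℕ) → (idx L (cubic d (evenPeriod t)) k → ℂ)}
    (hV₁ : ∀ i t, LipschitzBackground L (cubic d (evenPeriod t)) (V₁ i t) α β) (hV₂ : ∀ i t, LipschitzBackground L (cubic d (evenPeriod t)) (V₂ i t) α β)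
    (hW : ∀ i t, BoundedBackground L (cubic d (evenPeriod t)) (W i t) α' β')
    (hV₁1 : ∀ i k (μ f : Fin d) (z : Fin d → ℤ), ∃ s : ℂ, Tendsto (fun t => V₁ i t k μ (castT (cubic d (lev L k * evenPeriod t)) z, f)) atTop (𝓝 s))
    (hV₂1 : ∀ i k (μ f : Fin d) (z : Fin d → ℤ), ∃ s : ℂ, Tendsto (fun t => V₂ i t k μ (castT (cubic d (lev L k * evenPeriod t)) z, f)) atTop (𝓝 s))
    (hW1 : ∀ i k (f : Fin d) (z : Fin d → ℤ), ∃ s : ℂ, Tendsto (fun t => W i t k (castT (cubic d (lev L k * evenPeriod t)) z, f)) atTop (𝓝 s))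
    {u : ℂ} (hu : ‖u‖ ≤ T) (ℓ : List (Option (List σ))) :
    ∃ κ₁ B B' : ℝ, 0 < κ₁ ∧ 0 ≤ B ∧ 0 ≤ B' ∧
      (∀ t k, EntryDecay (distK L (cubic d (evenPeriod t)))
        ((ℓ.map fun o => o.elim (fun t k => (avgTow (QBlev L (cubic d (evenPeriod t))) ((L : ℝ) ^ d)
            (fun k' => (calDalev L (cubic d (evenPeriod t)) a ha k' + u • (Pmodel L (cubic d (evenPeriod t)) (U₁ t) k' + (Pmodel L (cubic d (evenPeriod t)) (U₂ t) k')ᴴ + Matrix.diagonal (Z t k')))⁻¹) k)⁻¹)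
          (fun w t k => avgTow (QBlev L (cubic d (evenPeriod t))) ((L : ℝ) ^ d)
            (fun k' => List.foldr (fun i N =>
                (calDalev L (cubic d (evenPeriod t)) a ha k' + u • (Pmodel L (cubic d (evenPeriod t)) (U₁ t) k' + (Pmodel L (cubic d (evenPeriod t)) (U₂ t) k')ᴴ + Matrix.diagonal (Z t k')))⁻¹
                * (Pmodel L (cubic d (evenPeriod t)) (V₁ i t) k' + (Pmodel L (cubic d (evenPeriod t)) (V₂ i t) k')ᴴ + Matrix.diagonal (W i t k')) * N)
              (calDalev L (cubic d (evenPeriod t)) a ha k' + u • (Pmodel L (cubic d (evenPeriod t)) (U₁ t) k' + (Pmodel L (cubic d (evenPeriod t)) (U₂ t) k')ᴴ + Matrix.diagonal (Z t k')))⁻¹ w) k)).prod t k) B κ₁) ∧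
      (∀ t, TwoLevelDecayRate (distK L (cubic d (evenPeriod t)))
        ((ℓ.map fun o => o.elim (fun t k => (avgTow (QBlev L (cubic d (evenPeriod t))) ((L : ℝ) ^ d)
            (fun k' => (calDalev L (cubic d (evenPeriod t)) a ha k' + u • (Pmodel L (cubic d (evenPeriod t)) (U₁ t) k' + (Pmodel L (cubic d (evenPeriod t)) (U₂ t) k')ᴴ + Matrix.diagonal (Z t k')))⁻¹) k)⁻¹)
          (fun w t k => avgTow (QBlev L (cubic d (evenPeriod t))) ((L : ℝ) ^ d)
            (fun k' => List.foldr (fun i N =>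
                (calDalev L (cubic d (evenPeriod t)) a ha k' + u • (Pmodel L (cubic d (evenPeriod t)) (U₁ t) k' + (Pmodel L (cubic d (evenPeriod t)) (U₂ t) k')ᴴ + Matrix.diagonal (Z t k')))⁻¹
                * (Pmodel L (cubic d (evenPeriod t)) (V₁ i t) k' + (Pmodel L (cubic d (evenPeriod t)) (V₂ i t) k')ᴴ + Matrix.diagonal (W i t k')) * N)
              (calDalev L (cubic d (evenPeriod t)) a ha k' + u • (Pmodel L (cubic d (evenPeriod t)) (U₁ t) k' + (Pmodel L (cubic d (evenPeriod t)) (U₂ t) k')ᴴ + Matrix.diagonal (Z t k')))⁻¹ w) k)).prod t) B' κ₁ (Real.sqrt ((L : ℝ)⁻¹))) ∧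
      (∀ k μ ν (z z' : Fin d → ℤ), ∃ s' : ℂ, Tendsto (fun t =>
        (ℓ.map fun o => o.elim (fun t k => (avgTow (QBlev L (cubic d (evenPeriod t))) ((L : ℝ) ^ d)
            (fun k' => (calDalev L (cubic d (evenPeriod t)) a ha k' + u • (Pmodel L (cubic d (evenPeriod t)) (U₁ t) k' + (Pmodel L (cubic d (evenPeriod t)) (U₂ t) k')ᴴ + Matrix.diagonal (Z t k')))⁻¹) k)⁻¹)
          (fun w t k => avgTow (QBlev L (cubic d (evenPeriod t))) ((L : ℝ) ^ d)
            (fun k' => List.foldr (fun i N =>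
                (calDalev L (cubic d (evenPeriod t)) a ha k' + u • (Pmodel L (cubic d (evenPeriod t)) (U₁ t) k' + (Pmodel L (cubic d (evenPeriod t)) (U₂ t) k')ᴴ + Matrix.diagonal (Z t k')))⁻¹
                * (Pmodel L (cubic d (evenPeriod t)) (V₁ i t) k' + (Pmodel L (cubic d (evenPeriod t)) (V₂ i t) k')ᴴ + Matrix.diagonal (W i t k')) * N)
              (calDalev L (cubic d (evenPeriod t)) a ha k' + u • (Pmodel L (cubic d (evenPeriod t)) (U₁ t) k' + (Pmodel L (cubic d (evenPeriod t)) (U₂ t) k')ᴴ + Matrix.diagonal (Z t k')))⁻¹ w) k)).prod t k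
        ((unitIdx L (cubic d (evenPeriod t))).symm (castT (cubic d (evenPeriod t)) z, μ)) ((unitIdx L (cubic d (evenPeriod t))).symm (castT (cubic d (evenPeriod t)) z', ν)))
        atTop (𝓝 s')) := by
  have hd2 : 2 ≤ d := le_trans (by norm_num) hd
  refine list_prod_inputs L hd2 tendsto_evenPeriod (Real.sqrt_nonneg _) _ fun X hX => ?_
  obtain ⟨o, -, rfl⟩ := List.mem_map.mp hX
  exact couplingLetterAt_inputs L a ha hL hd hα₀ hβ₀ hα₀' hβ₀' hα hβ hα' hβ' ha' hκ0 hγ' hδ' hJA hT0 hT₁ hT₂ hT₃ hU₁ hU₂ hZ hU₁1 hU₂1 hZ1 hV₁ hV₂ hW hV₁1 hV₂1 hW1 hu o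

/-- **`couplingDiagramSumAt_inputs` — EVERY FINITE LINEAR COMBINATION OF DIAGRAMS AT THE BASE POINT HAS THE INPUT TRIPLE** [our proof]: PART 160's `sum_inputs` on
`couplingDiagramAt_inputs`. -/
theorem couplingDiagramSumAt_inputs (hL : 2 ≤ L) (hd : 3 ≤ d) {σ : Type*} {α₀ β₀ α₀' β₀' α β α' β' a' κ T : ℝ} (hα₀ : 0 ≤ α₀) (hβ₀ : 0 ≤ β₀) (hα₀' : 0 ≤ α₀') (hβ₀' : 0 ≤ β₀')
    (hα : 0 ≤ α) (hβ : 0 ≤ β) (hα' : 0 ≤ α') (hβ' : 0 ≤ β')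
    (ha' : 0 < a') (hκ0 : 0 < κ)
    (hγ' : Jfree d a' κ 1 < gammaPs d a') (hδ' : deltaK d a' κ 1 < sigma0 d a' ^ 2) (hJA : JA d a a' κ 1 < gamD d a) (hT0 : 0 ≤ T)
    (hT₁ : T * (2 * (d * (α₀ + β₀) * Cst d a) + α₀' * Cst d a) ≤ 1 / 2)
    (hT₂ : T * (d * (α₀ * G2 d a (max (JA d a a' κ 1) 0) (gamD d a - max (JA d a a' κ 1) 0) κ)
      + d * (Real.exp |κ| * (α₀ * G2 d a (max (JA d a a' κ 1) 0) (gamD d a - max (JA d a a' κ 1) 0) κ + β₀ * (gamD d a - max (JA d a a' κ 1) 0)⁻¹))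
      + α₀' * (gamD d a - max (JA d a a' κ 1) 0)⁻¹) ≤ 1 / 2)
    (hT₃ : 4 * T * (2 * (d * (α₀ + β₀) * Cst d a) + α₀' * Cst d a) * Cst d a ≤ gammaB d a)
    {U₁ U₂ : (t : ℕ) → (k : ℕ) → Fin d → (idx L (cubic d (evenPeriod t)) k → ℂ)} {Z : (t : ℕ) → (k : ℕ) → (idx L (cubic d (evenPeriod t)) k → ℂ)}
    (hU₁ : ∀ t, LipschitzBackground L (cubic d (evenPeriod t)) (U₁ t) α₀ β₀) (hU₂ : ∀ t, LipschitzBackground L (cubic d (evenPeriod t)) (U₂ t) α₀ β₀)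
    (hZ : ∀ t, BoundedBackground L (cubic d (evenPeriod t)) (Z t) α₀' β₀')
    (hU₁1 : ∀ k (μ f : Fin d) (z : Fin d → ℤ), ∃ s : ℂ, Tendsto (fun t => U₁ t k μ (castT (cubic d (lev L k * evenPeriod t)) z, f)) atTop (𝓝 s))
    (hU₂1 : ∀ k (μ f : Fin d) (z : Fin d → ℤ), ∃ s : ℂ, Tendsto (fun t => U₂ t k μ (castT (cubic d (lev L k * evenPeriod t)) z, f)) atTop (𝓝 s))
    (hZ1 : ∀ k (f : Fin d) (z : Fin d → ℤ), ∃ s : ℂ, Tendsto (fun t => Z t k (castT (cubic d (lev L k * evenPeriod t)) z, f)) atTop (𝓝 s))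
    {V₁ V₂ : σ → (t : ℕ) → (k : ℕ) → Fin d → (idx L (cubic d (evenPeriod t)) k → ℂ)} {W : σ → (t : ℕ) → (k : ℕ) → (idx L (cubic d (evenPeriod t)) k → ℂ)}
    (hV₁ : ∀ i t, LipschitzBackground L (cubic d (evenPeriod t)) (V₁ i t) α β) (hV₂ : ∀ i t, LipschitzBackground L (cubic d (evenPeriod t)) (V₂ i t) α β)
    (hW : ∀ i t, BoundedBackground L (cubic d (evenPeriod t)) (W i t) α' β')
    (hV₁1 : ∀ i k (μ f : Fin d) (z : Fin d → ℤ), ∃ s : ℂ, Tendsto (fun t => V₁ i t k μ (castT (cubic d (lev L k * evenPeriod t)) z, f)) atTop (𝓝 s))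
    (hV₂1 : ∀ i k (μ f : Fin d) (z : Fin d → ℤ), ∃ s : ℂ, Tendsto (fun t => V₂ i t k μ (castT (cubic d (lev L k * evenPeriod t)) z, f)) atTop (𝓝 s))
    (hW1 : ∀ i k (f : Fin d) (z : Fin d → ℤ), ∃ s : ℂ, Tendsto (fun t => W i t k (castT (cubic d (lev L k * evenPeriod t)) z, f)) atTop (𝓝 s))
    {u : ℂ} (hu : ‖u‖ ≤ T) {J : Type*} (s : Finset J) (coef : J → ℂ) (ℓ : J → List (Option (List σ))) :
    ∃ κ₁ B B' : ℝ, 0 < κ₁ ∧ 0 ≤ B ∧ 0 ≤ B' ∧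
      (∀ t k, EntryDecay (distK L (cubic d (evenPeriod t)))
        ((∑ j ∈ s, coef j • ((ℓ j).map fun o => o.elim (fun t k => (avgTow (QBlev L (cubic d (evenPeriod t))) ((L : ℝ) ^ d)
            (fun k' => (calDalev L (cubic d (evenPeriod t)) a ha k' + u • (Pmodel L (cubic d (evenPeriod t)) (U₁ t) k' + (Pmodel L (cubic d (evenPeriod t)) (U₂ t) k')ᴴ + Matrix.diagonal (Z t k')))⁻¹) k)⁻¹)
          (fun w t k => avgTow (QBlev L (cubic d (evenPeriod t))) ((L : ℝ) ^ d)
            (fun k' => List.foldr (fun i N =>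
                (calDalev L (cubic d (evenPeriod t)) a ha k' + u • (Pmodel L (cubic d (evenPeriod t)) (U₁ t) k' + (Pmodel L (cubic d (evenPeriod t)) (U₂ t) k')ᴴ + Matrix.diagonal (Z t k')))⁻¹
                * (Pmodel L (cubic d (evenPeriod t)) (V₁ i t) k' + (Pmodel L (cubic d (evenPeriod t)) (V₂ i t) k')ᴴ + Matrix.diagonal (W i t k')) * N)
              (calDalev L (cubic d (evenPeriod t)) a ha k' + u • (Pmodel L (cubic d (evenPeriod t)) (U₁ t) k' + (Pmodel L (cubic d (evenPeriod t)) (U₂ t) k')ᴴ + Matrix.diagonal (Z t k')))⁻¹ w) k)).prod) t k) B κ₁) ∧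
      (∀ t, TwoLevelDecayRate (distK L (cubic d (evenPeriod t)))
        ((∑ j ∈ s, coef j • ((ℓ j).map fun o => o.elim (fun t k => (avgTow (QBlev L (cubic d (evenPeriod t))) ((L : ℝ) ^ d)
            (fun k' => (calDalev L (cubic d (evenPeriod t)) a ha k' + u • (Pmodel L (cubic d (evenPeriod t)) (U₁ t) k' + (Pmodel L (cubic d (evenPeriod t)) (U₂ t) k')ᴴ + Matrix.diagonal (Z t k')))⁻¹) k)⁻¹)
          (fun w t k => avgTow (QBlev L (cubic d (evenPeriod t))) ((L : ℝ) ^ d)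
            (fun k' => List.foldr (fun i N =>
                (calDalev L (cubic d (evenPeriod t)) a ha k' + u • (Pmodel L (cubic d (evenPeriod t)) (U₁ t) k' + (Pmodel L (cubic d (evenPeriod t)) (U₂ t) k')ᴴ + Matrix.diagonal (Z t k')))⁻¹
                * (Pmodel L (cubic d (evenPeriod t)) (V₁ i t) k' + (Pmodel L (cubic d (evenPeriod t)) (V₂ i t) k')ᴴ + Matrix.diagonal (W i t k')) * N)
              (calDalev L (cubic d (evenPeriod t)) a ha k' + u • (Pmodel L (cubic d (evenPeriod t)) (U₁ t) k' + (Pmodel L (cubic d (evenPeriod t)) (U₂ t) k')ᴴ + Matrix.diagonal (Z t k')))⁻¹ w) k)).prod) t) B' κ₁ (Real.sqrt ((L : ℝ)⁻¹))) ∧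
      (∀ k μ ν (z z' : Fin d → ℤ), ∃ s' : ℂ, Tendsto (fun t =>
        (∑ j ∈ s, coef j • ((ℓ j).map fun o => o.elim (fun t k => (avgTow (QBlev L (cubic d (evenPeriod t))) ((L : ℝ) ^ d)
            (fun k' => (calDalev L (cubic d (evenPeriod t)) a ha k' + u • (Pmodel L (cubic d (evenPeriod t)) (U₁ t) k' + (Pmodel L (cubic d (evenPeriod t)) (U₂ t) k')ᴴ + Matrix.diagonal (Z t k')))⁻¹) k)⁻¹)
          (fun w t k => avgTow (QBlev L (cubic d (evenPeriod t))) ((L : ℝ) ^ d)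
            (fun k' => List.foldr (fun i N =>
                (calDalev L (cubic d (evenPeriod t)) a ha k' + u • (Pmodel L (cubic d (evenPeriod t)) (U₁ t) k' + (Pmodel L (cubic d (evenPeriod t)) (U₂ t) k')ᴴ + Matrix.diagonal (Z t k')))⁻¹
                * (Pmodel L (cubic d (evenPeriod t)) (V₁ i t) k' + (Pmodel L (cubic d (evenPeriod t)) (V₂ i t) k')ᴴ + Matrix.diagonal (W i t k')) * N)
              (calDalev L (cubic d (evenPeriod t)) a ha k' + u • (Pmodel L (cubic d (evenPeriod t)) (U₁ t) k' + (Pmodel L (cubic d (evenPeriod t)) (U₂ t) k')ᴴ + Matrix.diagonal (Z t k')))⁻¹ w) k)).prod) t k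
        ((unitIdx L (cubic d (evenPeriod t))).symm (castT (cubic d (evenPeriod t)) z, μ)) ((unitIdx L (cubic d (evenPeriod t))).symm (castT (cubic d (evenPeriod t)) z', ν)))
        atTop (𝓝 s')) :=
  sum_inputs L (Real.sqrt_nonneg _) s coef _ fun j _ => couplingDiagramAt_inputs L a ha hL hd hα₀ hβ₀ hα₀' hβ₀' hα hβ hα' hβ' ha' hκ0 hγ' hδ' hJA hT0 hT₁ hT₂ hT₃ hU₁ hU₂ hZ hU₁1 hU₂1 hZ1 hV₁ hV₂ hW hV₁1 hV₂1 hW1 hu (ℓ j)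

/-- **`conv_couplingDiagramSumAt_of_tendsto_background` — THE BACKGROUND EXPANSION OF THE EFFECTIVE FORM TO ALL ORDERS AROUND A NONZERO SMALL BACKGROUND, ON `ℤ^d`, MODULO ONLY
THE BACKGROUNDS' POINTWISE LIMITS** [our proof] (`d ≥ 3`, `L ≥ 2`, `a > 0`, `μ ≠ ν`, even cubic volumes `2(t+1)`; base coupling letter on the three-condition disc, `‖u‖ ≤ T`; an
arbitrary family of coupling letters; EL₁ DISPLAYED): EVERY finite `ℂ`-linear combination `Σ_{j ∈ s} a_j • Π_{o ∈ ℓ_j} letter_u(o)` of diagrams in the letters `c_k(u)⁻¹` and `X_{w,k}(u)`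
has `∃ κ > 0, B, B′ ≥ 0, Π` with `IsInfiniteVolumeLimit`, `UniformDecay Π μ ν B (κ∕d)`, `StepRate Π μ ν B′ (κ∕d) (√(L⁻¹))`, `KernelInputs d Π`,
`∀ k, |secondMoment (Π k) μ ν − secondMoment (limKernelOf Π) μ ν| ≤ β′_d(B′∕(1−√(L⁻¹)), κ∕d)·(√(L⁻¹))^k` — `couplingDiagramSumAt_inputs` + PART 140's generic END (PART 238 is `u = 0`).
[cite: Balaban1987RG1, (1.21)–(1.22) p.264 (shapes)] -/
theorem conv_couplingDiagramSumAt_of_tendsto_background (hL : 2 ≤ L) (hd : 3 ≤ d) {σ : Type*} {α₀ β₀ α₀' β₀' α β α' β' a' κ T : ℝ} (hα₀ : 0 ≤ α₀) (hβ₀ : 0 ≤ β₀) (hα₀' : 0 ≤ α₀') (hβ₀' : 0 ≤ β₀')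
    (hα : 0 ≤ α) (hβ : 0 ≤ β) (hα' : 0 ≤ α') (hβ' : 0 ≤ β')
    (ha' : 0 < a') (hκ0 : 0 < κ)
    (hγ' : Jfree d a' κ 1 < gammaPs d a') (hδ' : deltaK d a' κ 1 < sigma0 d a' ^ 2) (hJA : JA d a a' κ 1 < gamD d a) (hT0 : 0 ≤ T)
    (hT₁ : T * (2 * (d * (α₀ + β₀) * Cst d a) + α₀' * Cst d a) ≤ 1 / 2)
    (hT₂ : T * (d * (α₀ * G2 d a (max (JA d a a' κ 1) 0) (gamD d a - max (JA d a a' κ 1) 0) κ)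
      + d * (Real.exp |κ| * (α₀ * G2 d a (max (JA d a a' κ 1) 0) (gamD d a - max (JA d a a' κ 1) 0) κ + β₀ * (gamD d a - max (JA d a a' κ 1) 0)⁻¹))
      + α₀' * (gamD d a - max (JA d a a' κ 1) 0)⁻¹) ≤ 1 / 2)
    (hT₃ : 4 * T * (2 * (d * (α₀ + β₀) * Cst d a) + α₀' * Cst d a) * Cst d a ≤ gammaB d a)
    {U₁ U₂ : (t : ℕ) → (k : ℕ) → Fin d → (idx L (cubic d (evenPeriod t)) k → ℂ)} {Z : (t : ℕ) → (k : ℕ) → (idx L (cubic d (evenPeriod t)) k → ℂ)}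
    (hU₁ : ∀ t, LipschitzBackground L (cubic d (evenPeriod t)) (U₁ t) α₀ β₀) (hU₂ : ∀ t, LipschitzBackground L (cubic d (evenPeriod t)) (U₂ t) α₀ β₀)
    (hZ : ∀ t, BoundedBackground L (cubic d (evenPeriod t)) (Z t) α₀' β₀')
    (hU₁1 : ∀ k (μ f : Fin d) (z : Fin d → ℤ), ∃ s : ℂ, Tendsto (fun t => U₁ t k μ (castT (cubic d (lev L k * evenPeriod t)) z, f)) atTop (𝓝 s))
    (hU₂1 : ∀ k (μ f : Fin d) (z : Fin d → ℤ), ∃ s : ℂ, Tendsto (fun t => U₂ t k μ (castT (cubic d (lev L k * evenPeriod t)) z, f)) atTop (𝓝 s))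
    (hZ1 : ∀ k (f : Fin d) (z : Fin d → ℤ), ∃ s : ℂ, Tendsto (fun t => Z t k (castT (cubic d (lev L k * evenPeriod t)) z, f)) atTop (𝓝 s))
    {V₁ V₂ : σ → (t : ℕ) → (k : ℕ) → Fin d → (idx L (cubic d (evenPeriod t)) k → ℂ)} {W : σ → (t : ℕ) → (k : ℕ) → (idx L (cubic d (evenPeriod t)) k → ℂ)}
    (hV₁ : ∀ i t, LipschitzBackground L (cubic d (evenPeriod t)) (V₁ i t) α β) (hV₂ : ∀ i t, LipschitzBackground L (cubic d (evenPeriod t)) (V₂ i t) α β)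
    (hW : ∀ i t, BoundedBackground L (cubic d (evenPeriod t)) (W i t) α' β')
    (hV₁1 : ∀ i k (μ f : Fin d) (z : Fin d → ℤ), ∃ s : ℂ, Tendsto (fun t => V₁ i t k μ (castT (cubic d (lev L k * evenPeriod t)) z, f)) atTop (𝓝 s))
    (hV₂1 : ∀ i k (μ f : Fin d) (z : Fin d → ℤ), ∃ s : ℂ, Tendsto (fun t => V₂ i t k μ (castT (cubic d (lev L k * evenPeriod t)) z, f)) atTop (𝓝 s))
    (hW1 : ∀ i k (f : Fin d) (z : Fin d → ℤ), ∃ s : ℂ, Tendsto (fun t => W i t k (castT (cubic d (lev L k * evenPeriod t)) z, f)) atTop (𝓝 s))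
    {u : ℂ} (hu : ‖u‖ ≤ T) {μ ν : Fin d} (hne : μ ≠ ν) {J : Type*} (s : Finset J) (coef : J → ℂ)
    (ℓ : J → List (Option (List σ))) :
    ∃ κ₁ B B' : ℝ, 0 < κ₁ ∧ 0 ≤ B ∧ 0 ≤ B' ∧ ∃ Pinf : ℕ → B12Beta.Kernel d,
      (∀ k, IsInfiniteVolumeLimit evenPeriod
        (fun t μ' ν' (z : Site d (evenPeriod t)) => ((∑ j ∈ s, coef j • ((ℓ j).map fun o => o.elim (fun t k => (avgTow (QBlev L (cubic d (evenPeriod t))) ((L : ℝ) ^ d)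
            (fun k' => (calDalev L (cubic d (evenPeriod t)) a ha k' + u • (Pmodel L (cubic d (evenPeriod t)) (U₁ t) k' + (Pmodel L (cubic d (evenPeriod t)) (U₂ t) k')ᴴ + Matrix.diagonal (Z t k')))⁻¹) k)⁻¹)
          (fun w t k => avgTow (QBlev L (cubic d (evenPeriod t))) ((L : ℝ) ^ d)
            (fun k' => List.foldr (fun i N =>
                (calDalev L (cubic d (evenPeriod t)) a ha k' + u • (Pmodel L (cubic d (evenPeriod t)) (U₁ t) k' + (Pmodel L (cubic d (evenPeriod t)) (U₂ t) k')ᴴ + Matrix.diagonal (Z t k')))⁻¹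
                * (Pmodel L (cubic d (evenPeriod t)) (V₁ i t) k' + (Pmodel L (cubic d (evenPeriod t)) (V₂ i t) k')ᴴ + Matrix.diagonal (W i t k')) * N)
              (calDalev L (cubic d (evenPeriod t)) a ha k' + u • (Pmodel L (cubic d (evenPeriod t)) (U₁ t) k' + (Pmodel L (cubic d (evenPeriod t)) (U₂ t) k')ᴴ + Matrix.diagonal (Z t k')))⁻¹ w) k)).prod) t k
          ((unitIdx L (cubic d (evenPeriod t))).symm (z, μ')) ((unitIdx L (cubic d (evenPeriod t))).symm (0, ν'))).re) (Pinf k)) ∧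
      Beta.LimitRate.UniformDecay Pinf μ ν B (κ₁ / d) ∧ StepRate Pinf μ ν B' (κ₁ / d) (Real.sqrt ((L : ℝ)⁻¹)) ∧
      (∃ K : KernelInputs d Pinf, K.θ = Real.sqrt ((L : ℝ)⁻¹) ∧ K.c₀ = betaPrime510 d (B' / (1 - Real.sqrt ((L : ℝ)⁻¹))) (κ₁ / d) ∧ K.Pinf = limKernelOf Pinf ∧ K.μ = μ ∧ K.ν = ν) ∧
      (∀ k, |B12Beta.secondMoment (Pinf k) μ ν - B12Beta.secondMoment (limKernelOf Pinf) μ ν|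
          ≤ betaPrime510 d (B' / (1 - Real.sqrt ((L : ℝ)⁻¹))) (κ₁ / d) * Real.sqrt ((L : ℝ)⁻¹) ^ k) := by
  have hd1 : 1 ≤ d := le_trans (by norm_num) hd
  have hL1 : (1 : ℝ) < L := by exact_mod_cast (lt_of_lt_of_le one_lt_two hL : 1 < L)
  have hθ1 : Real.sqrt ((L : ℝ)⁻¹) < 1 := by
    rw [show (1 : ℝ) = Real.sqrt 1 from Real.sqrt_one.symm]
    exact Real.sqrt_lt_sqrt (inv_nonneg.mpr (Nat.cast_nonneg _)) (inv_lt_one_of_one_lt₀ hL1)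
  obtain ⟨κ₁, B, B', hκ₁, hB, hB', hud, hsr, hel⟩ := couplingDiagramSumAt_inputs L a ha hL hd hα₀ hβ₀ hα₀' hβ₀' hα hβ hα' hβ' ha' hκ0 hγ' hδ' hJA hT0 hT₁ hT₂ hT₃ hU₁ hU₂ hZ hU₁1 hU₂1 hZ1 hV₁ hV₂ hW hV₁1 hV₂1 hW1 hu s coef ℓ
  have hlim := fun k (μ' ν' : Fin d) (z : Fin d → ℤ) => by
    have h := hel k μ' ν' z 0
    have e0 : ∀ t, castT (cubic d (evenPeriod t)) (0 : Fin d → ℤ) = 0 := fun t => by funext i; simp [castT]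
    simp only [e0] at h
    exact h
  obtain ⟨Pinf, hP⟩ := conv_of_decay_of_tendsto L hd1 tendsto_evenPeriod hκ₁ (Real.sqrt_nonneg _) hθ1 hud hsr hlim hne
  exact ⟨κ₁, B, B', hκ₁, hB, hB', Pinf, hP⟩


end Summit.QuantumFields.BalabanUV.Beta.GAN24.CouplingDiagramsAtCoupling

end
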